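import Summits.AnomalousDissipation.AnomalousDissipation.Theorems.TwodBoundedEnergyZeroMomentum.Negative.FirstShellGalerkin
import Literature.Analysis.FluidPDE.LinearizedNSTorus
import Literature.Analysis.FluidPDE.TorusClassicalH1Balance
import Literature.Analysis.FunctionSpaces.TorusFluidGlueProofs
import Literature.Analysis.FunctionSpaces.TorusEnstrophyOrthogonality

/-!
# Steady states of the crux `TwoAndHalfD.TwodBoundedEnergyZeroMomentum`: energy, enstrophy and the
single-shell straddle identity (negative-side toolbox, cdisprove seat
`refuter-cdisprove-stmt-AnomalousDissipation-10786-g2-0`, generation 2)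

Every round-1 crux idea for stmt-AnomalousDissipation-10786 takes its witnesses to be smooth
zero-mean STEADY states `v` of `NS_ν(g)` (`Torus.IsSteadyNSState ν g v p`, i.e. classical
solutions on `ℝ × 𝕋²` constant in time).  This file records, in that vocabulary, the exact
balance laws such a witness obeys (Constantin–Tarfulea–Vicol 2013, arXiv:1305.7089, §2):

* `steady_convect_eq` — the steady momentum equation `(v·∇)v = νΔv - ∇p + g` (the one-sided
  time derivative of a constant path vanishes); `steady_restrict_Icc`, `steady_isSmooth(_force)`.
* `steady_energy_identity` — `ν ‖∇v‖₂² = ∫⟪g, v⟫` (work = dissipation; CTV §2 first display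
  after (stns)); in particular the work is non-negative and `O(ν)` along a bounded-enstrophy branch.
* `steady_enstrophy_identity` (2-D) — `ν ∫‖Δv‖² = -∫⟪v, Δg⟫` (pair the momentum equation with
  `Δv`: the trilinear term drops out on `𝕋²`, `Torus.integral_inner_laplacian_convect_self_eq_zero`,
  and the pressure because `Δv` is divergence free; CTV §2 second display).
* `steady_laplacian_sq_eq_of_stokesEigenforce` — THE SINGLE-SHELL IDENTITY (CTV §2 (h2bal)):
  if `Δg = -Λ g` (Kolmogorov forcing: `g` in one Stokes eigenspace) and `ν ≠ 0`, then
  `∫ ‖Δv‖² = Λ ‖∇v‖₂²` for EVERY steady state — spectrally `∑_k λ_k(λ_k - Λ)|v̂_k|² = 0`,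
  `λ_k = 4π²|k|²`: a steady witness under single-shell forcing must STRADDLE the forcing shell
  (carry modes strictly above it as soon as it carries any mode strictly below it, e.g. a
  first-shell condensate), the "exact steady straddle identity" invoked by the cards
  parity-protected-swept-condensate and bilinear-euler-orbit-selection; for a first-shell force
  (`Λ = 4π²`, `laplacian_of_firstShell`) it reads `∫‖Δv‖² = 4π² ‖∇v‖₂²`, i.e. `v` itself lies in
  the first eigenspace (every other shell has `λ_k > 4π²`), the steady face of Marchioro's rigidity.

* `steady_hasSum_straddle`, `steady_no_subshell_mode_of_no_supershell_mode` — the same in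
  Fourier variables (Parseval for `∇v` and `Δv`): `∑_k λ_k(λ_k - Λ)‖v̂(k)‖² = 0`, hence a steady
  state with no mode strictly above the forcing shell has none strictly below it (bar the mean).

No new definitions. References: Constantin–Tarfulea–Vicol, arXiv:1305.7089 §2; FMRT 2001
App. II.A (A.55).
-/

noncomputable section

open MeasureTheory Set Filter Topology UnitAddTorus
open scoped ENNReal NNReal InnerProductSpace

namespace Summit.AnomalousDissipation.AnomalousDissipation.Theorems.TwodBoundedEnergyZeroMomentum.Negative

open Literature.Analysis.FunctionSpaces Literature.Analysis.FunctionSpaces.Torus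
open Literature.Analysis.FluidPDE Literature.Analysis.FluidPDE.Torus

section Steady

variable {d : Type*} [Fintype d] [DecidableEq d]
variable {ν : ℝ} {g v : UnitAddTorus d → EuclideanSpace ℝ d} {p : UnitAddTorus d → ℝ}

omit [DecidableEq d] in
/-- The one-sided time derivative of a constant path vanishes. [folklore] -/
theorem torus_timeDerivWithin_const (S : Set ℝ) (w : UnitAddTorus d → EuclideanSpace ℝ d) (t : ℝ)
    (x : UnitAddTorus d) : Torus.timeDerivWithin S (fun _ : ℝ => w) t x = 0 := by
  simp [Torus.timeDerivWithin]

/-- A steady state is smooth. [folklore] -/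
theorem steady_isSmooth (hv : IsSteadyNSState ν g v p) : IsSmooth v :=
  hv.smooth_velocity.isSmooth_slice (mem_univ (0 : ℝ))

/-- The pressure of a steady state is smooth. [folklore] -/
theorem steady_isSmooth_pressure (hv : IsSteadyNSState ν g v p) : IsSmooth p :=
  hv.smooth_pressure.isSmooth_slice (mem_univ (0 : ℝ))

/-- A steady state is divergence free. [folklore] -/
theorem steady_isDivFree (hv : IsSteadyNSState ν g v p) : IsDivFree v :=
  hv.divFree 0 (mem_univ _)

/-- **The steady momentum equation**: `(v·∇)v = νΔv - ∇p + g` pointwise. [folklore] -/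
theorem steady_convect_eq (hv : IsSteadyNSState ν g v p) (x : UnitAddTorus d) :
    convect v v x = ν • laplacian v x - gradient p x + g x := by
  have h := hv.momentum 0 (mem_univ _) x
  rwa [torus_timeDerivWithin_const, zero_add] at h

/-- The force of a steady state is smooth (it is `(v·∇)v - νΔv + ∇p`). [folklore] -/
theorem steady_isSmooth_force (hv : IsSteadyNSState ν g v p) : IsSmooth g := by
  have hfun : g = fun x => convect v v x - ν • laplacian v x + gradient p x := by
    funext x
    rw [steady_convect_eq hv x]
    abel
  rw [hfun]
  exact (((steady_isSmooth hv).convect (steady_isSmooth hv)).sub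
    ((steady_isSmooth hv).laplacian.smul ν)).add (steady_isSmooth_pressure hv).gradient

/-- A steady state restricts to a classical solution on the window `[0, 1]`. [folklore] -/
theorem steady_restrict_Icc (hv : IsSteadyNSState ν g v p) :
    IsClassicalNSSolutionOn (Icc 0 1) ν (fun _ => g) (fun _ => v) (fun _ => p) where
  smooth_velocity := hv.smooth_velocity.mono (subset_univ _)
  smooth_pressure := hv.smooth_pressure.mono (subset_univ _)
  momentum := fun t _ x => by
    rw [torus_timeDerivWithin_const, zero_add]
    exact steady_convect_eq hv x
  divFree := fun t _ => hv.divFree t (mem_univ t)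

/-- **Energy identity of steady states**: `ν ‖∇v‖₂² = ∫ ⟪g, v⟫` (the kinetic energy of a
constant path has derivative `0 = -ν‖∇v‖² + ⟨g, v⟩`, `IsClassicalNSSolutionOn.energy_balance_holds`;
Constantin–Tarfulea–Vicol 2013 §2). In particular the work of the force is non-negative. [folklore] -/
theorem steady_energy_identity (hv : IsSteadyNSState ν g v p) :
    ν * gradNormSq v = ∫ x, ⟪g x, v x⟫_ℝ := by
  have h1 : HasDerivWithinAt (fun s : ℝ => kineticEnergy ((fun _ : ℝ => v) s))
      (-ν * gradNormSq v + ∫ x, ⟪g x, v x⟫_ℝ) univ 0 :=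
    IsClassicalNSSolutionOn.energy_balance_holds hv convex_univ (mem_univ 0)
  have h2 : HasDerivAt (fun _ : ℝ => kineticEnergy v) (-ν * gradNormSq v + ∫ x, ⟪g x, v x⟫_ℝ) 0 :=
    h1.hasDerivAt univ_mem
  have h3 : HasDerivAt (fun _ : ℝ => kineticEnergy v) 0 0 := hasDerivAt_const 0 _
  have h := h3.unique h2
  linarith

/-- The work of the force on a steady state is non-negative when `ν ≥ 0`. [folklore] -/
theorem steady_work_nonneg (hν : 0 ≤ ν) (hv : IsSteadyNSState ν g v p) :
    0 ≤ ∫ x, ⟪g x, v x⟫_ℝ := by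
  rw [← steady_energy_identity hv]
  exact mul_nonneg hν (integral_nonneg fun x => Finset.sum_nonneg fun i _ => sq_nonneg _)

end Steady

section TwoD

variable {ν : ℝ} {g v : UnitAddTorus (Fin 2) → EuclideanSpace ℝ (Fin 2)} {p : UnitAddTorus (Fin 2) → ℝ}

/-- **Green, symmetric form**: `∫ ⟪a, Δw⟫ = ∫ ⟪w, Δa⟫` for smooth fields on the torus. [folklore] -/
theorem integral_inner_laplacian_comm {d : Type*} [Fintype d] [DecidableEq d]
    {a w : UnitAddTorus d → EuclideanSpace ℝ d} (ha : IsSmooth a) (hw : IsSmooth w) :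
    ∫ x, ⟪a x, laplacian w x⟫_ℝ = ∫ x, ⟪w x, laplacian a x⟫_ℝ := by
  have h1 := Torus.sum_integral_inner_partialDeriv_eq_neg_integral_inner_laplacian ha hw
  have h2 := Torus.sum_integral_inner_partialDeriv_eq_neg_integral_inner_laplacian hw ha
  have h3 : ∑ i, ∫ x, ⟪partialDeriv i a x, partialDeriv i w x⟫_ℝ =
      ∑ i, ∫ x, ⟪partialDeriv i w x, partialDeriv i a x⟫_ℝ := by
    refine Finset.sum_congr rfl fun i _ => integral_congr_ae (ae_of_all _ fun x => ?_)
    exact real_inner_comm _ _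
  linarith

/-- **Enstrophy identity of steady states on `𝕋²`**: `ν ∫ ‖Δv‖² = -∫ ⟪v, Δg⟫`. Pair the
momentum equation with `Δv` (`IsClassicalNSSolutionOn.hasDerivWithinAt_half_gradNormSq` on a
constant path): the trilinear term vanishes in two dimensions
(`Torus.integral_inner_laplacian_convect_self_eq_zero`), the pressure drops out, and
`∫⟪g, Δv⟫ = ∫⟪v, Δg⟫` (Constantin–Tarfulea–Vicol 2013 §2; FMRT 2001 (A.55)). [folklore] -/
theorem steady_enstrophy_identity (hv : IsSteadyNSState ν g v p) :
    ν * ∫ x, ‖laplacian v x‖ ^ 2 = -∫ x, ⟪v x, laplacian g x⟫_ℝ := by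
  have hvs : IsSmooth v := steady_isSmooth hv
  have hgs : IsSmooth g := steady_isSmooth_force hv
  have hIcc := steady_restrict_Icc hv
  have h1 : HasDerivWithinAt (fun s : ℝ => 2⁻¹ * gradNormSq ((fun _ : ℝ => v) s))
      (-ν * (∫ x, ‖laplacian v x‖ ^ 2) +
        ∫ x, ⟪convect v v x - g x, laplacian v x⟫_ℝ) (Icc 0 1) 0 :=
    hIcc.hasDerivWithinAt_half_gradNormSq zero_lt_one (left_mem_Icc.2 zero_le_one)
  have hU : UniqueDiffWithinAt ℝ (Icc (0 : ℝ) 1) 0 :=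
    uniqueDiffOn_Icc zero_lt_one 0 (left_mem_Icc.2 zero_le_one)
  have h2 := h1.derivWithin hU
  have h3 : derivWithin (fun s : ℝ => 2⁻¹ * gradNormSq ((fun _ : ℝ => v) s)) (Icc 0 1) 0 = 0 := by
    simp
  rw [h3] at h2
  -- split the pairing
  have iC : Integrable (fun x => ⟪convect v v x, laplacian v x⟫_ℝ) volume :=
    ((hvs.convect hvs).inner hvs.laplacian).integrable
  have iG : Integrable (fun x => ⟪g x, laplacian v x⟫_ℝ) volume := (hgs.inner hvs.laplacian).integrable
  have hsplit : ∫ x, ⟪convect v v x - g x, laplacian v x⟫_ℝ =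
      (∫ x, ⟪convect v v x, laplacian v x⟫_ℝ) - ∫ x, ⟪g x, laplacian v x⟫_ℝ := by
    rw [← integral_sub iC iG]
    refine integral_congr_ae (ae_of_all _ fun x => ?_)
    exact inner_sub_left _ _ _
  have htri : ∫ x, ⟪convect v v x, laplacian v x⟫_ℝ = 0 := by
    have h := integral_inner_laplacian_convect_self_eq_zero hvs (steady_isDivFree hv)
    rw [← h]
    exact integral_congr_ae (ae_of_all _ fun x => real_inner_comm _ _)
  rw [hsplit, htri, zero_sub, integral_inner_laplacian_comm hgs hvs] at h2
  linarith

/-- **The single-shell identity (CTV 2013 §2 (h2bal))**: if the force is a Stokes eigenfield,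
`Δg = -Λ g` pointwise (e.g. Kolmogorov forcing on one Fourier shell, `Λ = 4π²|k|²`; the first
shell: `Λ = 4π²`, `laplacian_of_firstShell`), then EVERY smooth steady state of `NS_ν(g)`,
`ν ≠ 0`, satisfies `∫ ‖Δv‖² = Λ ‖∇v‖₂²` — spectrally `∑_k λ_k(λ_k - Λ)‖v̂(k)‖² = 0` with
`λ_k = 4π²|k|²`: the `(λ_k - Λ)`-weighted enstrophy above the forcing shell exactly balances the
deficit below it. STRADDLE CONSTRAINT for steady witnesses under single-shell forcing: a steady
state carrying a sub-forcing-shell component (a condensate) must carry super-forcing-shell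
modes too; and under a FIRST-shell force (`Λ = λ₁`) every weight `λ_k - Λ` is `≥ 0`, so the
steady state lies in the first eigenspace itself. [cite: ConstantinTarfuleaVicol2013, §2 (h2bal)] -/
theorem steady_laplacian_sq_eq_of_stokesEigenforce (hν : ν ≠ 0) (hv : IsSteadyNSState ν g v p)
    {Λ : ℝ} (hΛ : ∀ x, laplacian g x = -Λ • g x) :
    ∫ x, ‖laplacian v x‖ ^ 2 = Λ * gradNormSq v := by
  have h1 := steady_enstrophy_identity hv
  have h2 := steady_energy_identity hv
  have h3 : ∫ x, ⟪v x, laplacian g x⟫_ℝ = -Λ * ∫ x, ⟪g x, v x⟫_ℝ := by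
    rw [← integral_const_mul]
    refine integral_congr_ae (ae_of_all _ fun x => ?_)
    show ⟪v x, laplacian g x⟫_ℝ = -Λ * ⟪g x, v x⟫_ℝ
    rw [hΛ x, inner_smul_right, real_inner_comm]
  rw [h3, ← h2] at h1
  have h4 : ν * ∫ x, ‖laplacian v x‖ ^ 2 = ν * (Λ * gradNormSq v) := by linarith
  exact mul_left_cancel₀ hν h4

/-- **Steady states under a first-shell force have `∫‖Δv‖² = 4π² ‖∇v‖₂²`** — the first-shell
instance of the single-shell identity (`Λ = λ₁ = 4π²`); since `λ_k ≥ 8π²` on every other shell,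
the identity `∑_k λ_k(λ_k - 4π²)‖v̂(k)‖² = 0` forces the steady state into the first eigenspace
(the steady face of Marchioro's rigidity, here for the whole eigenspace). [folklore] -/
theorem steady_laplacian_sq_eq_of_firstShell (hν : ν ≠ 0) (hv : IsSteadyNSState ν g v p)
    (hg1 : ∀ k : Fin 2 → ℤ, freqNormSq k ≠ 1 → mFourierCoeff (EuclideanSpace.complexify ∘ g) k = 0) :
    ∫ x, ‖laplacian v x‖ ^ 2 = 4 * Real.pi ^ 2 * gradNormSq v :=
  steady_laplacian_sq_eq_of_stokesEigenforce hν hv fun x =>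
    laplacian_of_firstShell (steady_isSmooth_force hv).continuous hg1 x

/-! ### The identity in Fourier variables: the straddle constraint -/

/-- **Parseval for the gradient of a smooth field, real form**:
`∑_k 4π²|k|² ‖v̂(k)‖² = ‖∇v‖₂²` (`Torus.tsum_freqNormSq_mul_enorm_sq_mFourierCoeff_complexify`). [folklore] -/
theorem hasSum_eigenvalue_mul_sq_norm_mFourierCoeff {d : Type*} [Fintype d] [DecidableEq d]
    {w : UnitAddTorus d → EuclideanSpace ℝ d} (hw : IsSmooth w) :
    HasSum (fun k : d → ℤ => 4 * Real.pi ^ 2 * freqNormSq k *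
      ‖mFourierCoeff (EuclideanSpace.complexify ∘ w) k‖ ^ 2) (gradNormSq w) := by
  set F : (d → ℤ) → ℝ≥0∞ := fun k => ENNReal.ofReal (freqNormSq k) *
    ‖mFourierCoeff (EuclideanSpace.complexify ∘ w) k‖ₑ ^ 2 with hF
  have hG0 : 0 ≤ gradNormSq w := gradNormSq_nonneg w
  have hc : 0 < 4 * Real.pi ^ 2 := by positivity
  have htsum : ∑' k, F k = ENNReal.ofReal ((4 * Real.pi ^ 2)⁻¹ * gradNormSq w) :=
    tsum_freqNormSq_mul_enorm_sq_mFourierCoeff_complexify hw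
  have hne : ∑' k, F k ≠ ⊤ := by rw [htsum]; exact ENNReal.ofReal_ne_top
  have hFk : ∀ k, F k ≠ ⊤ := fun k => ENNReal.mul_ne_top ENNReal.ofReal_ne_top
    (ENNReal.pow_ne_top enorm_ne_top)
  have h1 : HasSum (fun k => (F k).toReal) (∑' k, (F k).toReal) := ENNReal.hasSum_toReal hne
  rw [← ENNReal.tsum_toReal_eq hFk, htsum, ENNReal.toReal_ofReal (by positivity)] at h1
  have hterm : ∀ k, (F k).toReal = freqNormSq k * ‖mFourierCoeff (EuclideanSpace.complexify ∘ w) k‖ ^ 2 := by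
    intro k
    rw [hF]
    simp only
    rw [ENNReal.toReal_mul, ENNReal.toReal_ofReal (freqNormSq_nonneg k), ENNReal.toReal_pow,
      toReal_enorm]
  simp_rw [hterm] at h1
  have h2 := h1.mul_left (4 * Real.pi ^ 2)
  rw [← mul_assoc, mul_inv_cancel₀ hc.ne', one_mul] at h2
  refine h2.congr_fun fun k => ?_
  ring

/-- **Parseval for the Laplacian of a smooth field**: `∑_k (4π²|k|²)² ‖v̂(k)‖² = ∫ ‖Δv‖²`
(`𝓕(Δv)(k) = -4π²|k|² v̂(k)`). [folklore] -/
theorem hasSum_eigenvalue_sq_mul_sq_norm_mFourierCoeff {d : Type*} [Fintype d] [DecidableEq d]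
    {w : UnitAddTorus d → EuclideanSpace ℝ d} (hw : IsSmooth w) :
    HasSum (fun k : d → ℤ => (4 * Real.pi ^ 2 * freqNormSq k) ^ 2 *
      ‖mFourierCoeff (EuclideanSpace.complexify ∘ w) k‖ ^ 2) (∫ x, ‖laplacian w x‖ ^ 2) := by
  have h := hasSum_sq_norm_mFourierCoeff_complexify (hw.laplacian.memLp 2)
  refine h.congr_fun fun k => ?_
  have h0 : 0 ≤ 4 * Real.pi ^ 2 * freqNormSq k := by
    have := freqNormSq_nonneg k
    positivity
  rw [mFourierCoeff_complexify_laplacian hw k, norm_neg, norm_smul, Complex.norm_real,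
    Real.norm_eq_abs, abs_of_nonneg h0]
  ring

/-- **The single-shell identity in Fourier variables (the STRADDLE identity)**: for a smooth
steady state of `NS_ν(g)` on `𝕋²`, `ν ≠ 0`, with a Stokes eigenforce `Δg = -Λg`,
`∑_k λ_k (λ_k - Λ) ‖v̂(k)‖² = 0`, `λ_k = 4π²|k|²` (Constantin–Tarfulea–Vicol 2013 §2, (h2bal)
read through Parseval): the `λ_k(λ_k - Λ)`-weighted energy ABOVE the forcing shell equals the
deficit BELOW it. [cite: ConstantinTarfuleaVicol2013, §2 (h2bal)] -/
theorem steady_hasSum_straddle (hν : ν ≠ 0) (hv : IsSteadyNSState ν g v p) {Λ : ℝ}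
    (hΛ : ∀ x, laplacian g x = -Λ • g x) :
    HasSum (fun k : Fin 2 → ℤ => 4 * Real.pi ^ 2 * freqNormSq k *
      (4 * Real.pi ^ 2 * freqNormSq k - Λ) *
        ‖mFourierCoeff (EuclideanSpace.complexify ∘ v) k‖ ^ 2) 0 := by
  have hvs := steady_isSmooth hv
  have hA := hasSum_eigenvalue_sq_mul_sq_norm_mFourierCoeff hvs
  have hB := (hasSum_eigenvalue_mul_sq_norm_mFourierCoeff hvs).mul_left Λ
  have hid := steady_laplacian_sq_eq_of_stokesEigenforce hν hv hΛ
  have h := hA.sub hB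
  rw [hid, sub_self] at h
  refine h.congr_fun fun k => ?_
  ring

/-- **STRADDLE CONSTRAINT.** A smooth steady state of `NS_ν(g)` on `𝕋²` (`ν ≠ 0`, Stokes
eigenforce `Δg = -Λg`) with NO Fourier mode strictly above the forcing shell
(`v̂(k) = 0` whenever `4π²|k|² > Λ`) has NO mode strictly below it either, apart from the mean:
`v̂(k) = 0` whenever `0 < 4π²|k|² < Λ`. (All terms of the straddle identity are then `≤ 0` and
sum to `0`.) Contrapositive, for the crux: a steady witness under single-shell (Kolmogorov)
forcing that carries a condensate below the forcing shell — as every bounded-energy scenario does —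
MUST carry modes strictly above the forcing shell. [cite: ConstantinTarfuleaVicol2013, §2 (h2bal)] -/
theorem steady_no_subshell_mode_of_no_supershell_mode (hν : ν ≠ 0) (hv : IsSteadyNSState ν g v p)
    {Λ : ℝ} (hΛ : ∀ x, laplacian g x = -Λ • g x)
    (habove : ∀ k : Fin 2 → ℤ, Λ < 4 * Real.pi ^ 2 * freqNormSq k →
      mFourierCoeff (EuclideanSpace.complexify ∘ v) k = 0)
    {k : Fin 2 → ℤ} (hk0 : 0 < freqNormSq k) (hk : 4 * Real.pi ^ 2 * freqNormSq k < Λ) :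
    mFourierCoeff (EuclideanSpace.complexify ∘ v) k = 0 := by
  set f : (Fin 2 → ℤ) → ℝ := fun k => 4 * Real.pi ^ 2 * freqNormSq k *
    (4 * Real.pi ^ 2 * freqNormSq k - Λ) * ‖mFourierCoeff (EuclideanSpace.complexify ∘ v) k‖ ^ 2
    with hf
  have hsum : HasSum f 0 := steady_hasSum_straddle hν hv hΛ
  -- every term is `≤ 0`
  have hle : ∀ k, f k ≤ 0 := by
    intro k
    simp only [hf]
    by_cases h : Λ < 4 * Real.pi ^ 2 * freqNormSq k
    · rw [habove k h, norm_zero, zero_pow two_ne_zero, mul_zero]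
    · push Not at h
      have h1 : 0 ≤ 4 * Real.pi ^ 2 * freqNormSq k := by
        have := freqNormSq_nonneg k
        positivity
      have h2 : 4 * Real.pi ^ 2 * freqNormSq k - Λ ≤ 0 := by linarith
      have h3 : 0 ≤ ‖mFourierCoeff (EuclideanSpace.complexify ∘ v) k‖ ^ 2 := sq_nonneg _
      have h4 : 4 * Real.pi ^ 2 * freqNormSq k * (4 * Real.pi ^ 2 * freqNormSq k - Λ) ≤ 0 := by
        nlinarith
      nlinarith
  -- hence every term is `0`
  have hneg : HasSum (fun k => -f k) 0 := by simpa using hsum.neg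
  have hzero : (fun k => -f k) = 0 :=
    (hasSum_zero_iff_of_nonneg fun k => neg_nonneg.2 (hle k)).1 hneg
  have hfk : f k = 0 := by
    have := congrFun hzero k
    simpa using this
  -- read off `v̂(k) = 0`
  simp only [hf] at hfk
  have h1 : 0 < 4 * Real.pi ^ 2 * freqNormSq k := mul_pos (by positivity) hk0
  have h2 : 4 * Real.pi ^ 2 * freqNormSq k - Λ ≠ 0 := by
    intro h
    linarith
  have h3 : ‖mFourierCoeff (EuclideanSpace.complexify ∘ v) k‖ ^ 2 = 0 := by
    rcases mul_eq_zero.1 hfk with h4 | h4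
    · rcases mul_eq_zero.1 h4 with h5 | h5
      · exact absurd h5 h1.ne'
      · exact absurd h5 h2
    · exact h4
  exact norm_eq_zero.1 (pow_eq_zero_iff two_ne_zero |>.1 h3)

end TwoD

end Summit.AnomalousDissipation.AnomalousDissipation.Theorems.TwodBoundedEnergyZeroMomentum.Negative

end
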